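import Literature.Computability.QuantumComplexity.ForrelationMSubspaceDuality

/-!
# Crux `CubicForrelation.SignedCubicForrelationInPrBPP` (stmt-QuantumAdvantage-13933)

Stub `stub_dualValue` of the line `polar-radical-seeds` (the DUAL-VALUE IDENTITY, Poisson regrouping).

Let `V ⊆ 𝔽₂ⁿ` be a finset of bit vectors containing `0` and closed under `⊕` (a linear subspace) and let
`g : 𝔽₂ⁿ → 𝔽₂` be affine on every coset of `V` (all second differences of `g` along `V` vanish). Say that
`x` MATCHES `z` when the character `v ↦ (-1)^{x·v}` of `V` is the linear part
`v ↦ (-1)^{g(z ⊕ v) + g(z)}` of `g` on the coset `z ⊕ V`.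

* (a) For every `f`, `Σ_z Σ_{x matching z} (-1)^{f x} (-1)^{g z} (-1)^{x·z} = √(2^{3n}) · Φ(f,g)`.
  For each fixed `x`, the `z`-sum over the `z` matched with `x` of `(-1)^{g z + z·x}` is the full Walsh
  coefficient `W_g(x) = Σ_z (-1)^{g z + z·x}`: the `±1`-valued function `v ↦ (-1)^{g(z⊕v)+g(z)+x·v}` is
  a multiplicative character of `V` (affineness of `g` on the coset of `z`), so it sums over `V` to `|V|`
  (trivial character: the coset of `z` matches `x`, and all its terms `(-1)^{g y + y·x}` coincide) or to
  `0` (no match and no contribution) — `stub_dualValue_dichotomy`, `stub_dualValue_W`; then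
  `Σ_x (-1)^{f x} W_g(x) = S(f,g) = √(2^{3n}) Φ(f,g)` (`fsum_eq_sum_mul_W`, `fsum_signOf_eq`).
* (b) For every `z`, `#{x matching z} · |V| = 2ⁿ` (`stub_dualValue_card`): count
  `Σ_x Σ_{v ∈ V} (-1)^{g(z⊕v)+g(z)} (-1)^{x·v}` two ways — by the same dichotomy it is
  `|V| · #{x matching z}`, and by orthogonality of characters (`Σ_x (-1)^{x·v} = 2ⁿ [v = 0]`) it is `2ⁿ`.

No bentness and no half-dimension hypothesis is needed. The argument of (a) is adapted from
`W_eq_sum_matched` / `fsum_eq_sum_matched` of the sibling line `seed-to-sign` of the same crux; tree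
material used: `sum_char_subspace`, `all_eq_of_sum_eq_card` (`ForrelationMSubspaceDuality`),
`fsum_eq_sum_mul_W` (`ForrelationDerivativeTables`), `fsum_signOf_eq`, `twist_bxor_left`
(`ForrelationSignTransport`), `sum_twist_left`, `bxorPerm` (`IQPForrelation`).
-/

noncomputable section

set_option linter.dupNamespace false -- D-0017: single-problem summit ⇒ `QuantumAdvantage.QuantumAdvantage` by design

namespace Summit.QuantumAdvantage.QuantumAdvantage.Theorems.SignedCubicForrelationInPrBPP

open Finset
open Literature.Computability.QuantumComplexity
open Literature.Computability.QuantumComplexity.BuzetChailloux (bxor zeroVec bxor_zeroVec bxorPerm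
  bxorPerm_apply bxor_comm twist_bxor_right sum_twist_left signOf_sq)
open Literature.Computability.QuantumComplexity.Simon (twist_eq_one_or)
open Literature.Computability.QuantumComplexity.DerivativeWalsh (W fsum_eq_sum_mul_W fsum_signOf_eq
  sum_char_subspace all_eq_of_sum_eq_card twist_bxor_left)

variable {n : ℕ}

/-- `(-1)^{b₁} (-1)^{b₂} (-1)^{x·v} = 1 ↔ (-1)^{x·v} = (-1)^{b₁} (-1)^{b₂}` (all three factors are `±1`). -/
private theorem stub_dualValue_chi_eq_one_iff (b₁ b₂ : Bool) (x v : Fin n → Bool) :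
    signOf b₁ * signOf b₂ * twist x v = 1 ↔ twist x v = signOf b₁ * signOf b₂ := by
  rcases twist_eq_one_or x v with h | h <;> cases b₁ <;> cases b₂ <;> norm_num [signOf, h]

/-- **The dichotomy.** For `g` affine on the cosets of the `⊕`-closed `V ∋ 0` and any `z`, `x`, the
`±1`-function `v ↦ (-1)^{g(z⊕v)} (-1)^{g z} (-1)^{x·v}` is a multiplicative character of `V`; either it is
trivial — its sum over `V` is `|V|` and `x` matches `z` — or its sum over `V` is `0` and `x` does not
match `z`. -/
private theorem stub_dualValue_dichotomy (g : (Fin n → Bool) → Bool) {V : Finset (Fin n → Bool)}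
    (h0 : zeroVec ∈ V) (hadd : ∀ x ∈ V, ∀ y ∈ V, bxor x y ∈ V)
    (hM : ∀ u ∈ V, ∀ v ∈ V, ∀ y, (g y ^^ g (bxor y u) ^^ g (bxor y v) ^^ g (bxor y (bxor u v))) = false)
    (z x : Fin n → Bool) :
    (∑ e ∈ V, signOf (g (bxor z e)) * signOf (g z) * twist x e = V.card ∧
        (∀ v ∈ V, twist x v = signOf (g (bxor z v)) * signOf (g z))) ∨
      (∑ e ∈ V, signOf (g (bxor z e)) * signOf (g z) * twist x e = 0 ∧
        ¬ (∀ v ∈ V, twist x v = signOf (g (bxor z v)) * signOf (g z))) := by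
  have hsq : ∀ e ∈ V, signOf (g (bxor z e)) * signOf (g z) * twist x e = 1 ∨
      signOf (g (bxor z e)) * signOf (g z) * twist x e = -1 := by
    intro e _
    rcases Bool.eq_false_or_eq_true (g (bxor z e)) with h1 | h1 <;>
      rcases Bool.eq_false_or_eq_true (g z) with h2 | h2 <;>
        rcases twist_eq_one_or x e with h3 | h3 <;> simp [signOf, h1, h2, h3]
  have hmul : ∀ u ∈ V, ∀ v ∈ V,
      signOf (g (bxor z (bxor u v))) * signOf (g z) * twist x (bxor u v) =
        (signOf (g (bxor z u)) * signOf (g z) * twist x u) *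
          (signOf (g (bxor z v)) * signOf (g z) * twist x v) := by
    intro u hu v hv
    have h4 := hM u hu v hv z
    rw [twist_bxor_right]
    have key : signOf (g (bxor z (bxor u v))) =
        signOf (g z) * signOf (g (bxor z u)) * signOf (g (bxor z v)) := by
      rcases Bool.eq_false_or_eq_true (g (bxor z (bxor u v))) with e1 | e1 <;>
        rcases Bool.eq_false_or_eq_true (g (bxor z u)) with e2 | e2 <;>
          rcases Bool.eq_false_or_eq_true (g (bxor z v)) with e3 | e3 <;>
            rcases Bool.eq_false_or_eq_true (g z) with e4 | e4 <;>
              simp only [e1, e2, e3, e4] at h4 ⊢ <;> simp [signOf] at h4 ⊢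
    rw [key]
    ring
  rcases sum_char_subspace hadd (fun e => signOf (g (bxor z e)) * signOf (g z) * twist x e) hsq hmul with
    h | h
  · left
    refine ⟨h, fun v hv => ?_⟩
    have h1 := all_eq_of_sum_eq_card V _ hsq 1 (Or.inl rfl) (by rw [one_mul]; exact h) v hv
    exact (stub_dualValue_chi_eq_one_iff _ _ x v).1 h1
  · right
    refine ⟨h, fun hall => ?_⟩
    have hall' : ∀ e ∈ V, signOf (g (bxor z e)) * signOf (g z) * twist x e = 1 :=
      fun e he => (stub_dualValue_chi_eq_one_iff _ _ x e).2 (hall e he)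
    have hc : ∑ e ∈ V, signOf (g (bxor z e)) * signOf (g z) * twist x e = V.card := by
      rw [sum_congr rfl hall', sum_const, nsmul_eq_mul, mul_one]
    have hV : (0 : ℝ) < V.card := by exact_mod_cast card_pos.2 ⟨_, h0⟩
    have h' : ∑ e ∈ V, signOf (g (bxor z e)) * signOf (g z) * twist x e = 0 := h
    rw [hc] at h'
    linarith

/-- **Part (b).** For every `z` the `x` matching `z` number `2ⁿ / |V|`: `#{x matching z} · |V| = 2ⁿ`
(count `Σ_x Σ_{v ∈ V} (-1)^{g(z⊕v)+g(z)+x·v}` by the dichotomy and by orthogonality of characters). -/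
private theorem stub_dualValue_card (g : (Fin n → Bool) → Bool) {V : Finset (Fin n → Bool)}
    (h0 : zeroVec ∈ V) (hadd : ∀ x ∈ V, ∀ y ∈ V, bxor x y ∈ V)
    (hM : ∀ u ∈ V, ∀ v ∈ V, ∀ y, (g y ^^ g (bxor y u) ^^ g (bxor y v) ^^ g (bxor y (bxor u v))) = false)
    (z : Fin n → Bool) :
    ((univ.filter (fun x => ∀ v ∈ V, twist x v = signOf (g (bxor z v)) * signOf (g z))).card : ℝ) *
        V.card = (2 : ℝ) ^ n := by
  have h1 : ∑ x : Fin n → Bool, ∑ e ∈ V, signOf (g (bxor z e)) * signOf (g z) * twist x e =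
      ((univ.filter (fun x => ∀ v ∈ V, twist x v = signOf (g (bxor z v)) * signOf (g z))).card : ℝ) *
        V.card := by
    have e1 : ∀ x : Fin n → Bool, ∑ e ∈ V, signOf (g (bxor z e)) * signOf (g z) * twist x e =
        if (∀ v ∈ V, twist x v = signOf (g (bxor z v)) * signOf (g z)) then (V.card : ℝ) else 0 := by
      intro x
      rcases stub_dualValue_dichotomy g h0 hadd hM z x with ⟨hs, hm⟩ | ⟨hs, hm⟩
      · rw [hs, if_pos hm]
      · rw [hs, if_neg hm]
    rw [sum_congr rfl fun x _ => e1 x, ← sum_filter, sum_const, nsmul_eq_mul]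
  have h2 : ∑ x : Fin n → Bool, ∑ e ∈ V, signOf (g (bxor z e)) * signOf (g z) * twist x e =
      (2 : ℝ) ^ n := by
    rw [sum_comm]
    have e2 : ∀ e ∈ V, ∑ x : Fin n → Bool, signOf (g (bxor z e)) * signOf (g z) * twist x e =
        if e = zeroVec then signOf (g (bxor z e)) * signOf (g z) * (2 : ℝ) ^ n else 0 := by
      intro e _
      rw [← mul_sum, sum_twist_left e, mul_ite, mul_zero]
    rw [sum_congr rfl e2, sum_ite_eq' V zeroVec, if_pos h0, bxor_zeroVec]
    have hs := signOf_sq (g z)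
    rw [sq] at hs
    rw [hs, one_mul]
  rw [← h1, h2]

/-- **The regrouped Walsh coefficient.** For `g` affine on the cosets of the `⊕`-closed `V ∋ 0` and every
`x`: `W_g(x) = Σ_{z : x matches z} (-1)^{g z} (-1)^{z·x}` (each coset of `V` contributes `|V|` equal terms
or nothing; undo the `|V|`-fold overcount by reindexing). -/
private theorem stub_dualValue_W (g : (Fin n → Bool) → Bool) {V : Finset (Fin n → Bool)}
    (h0 : zeroVec ∈ V) (hadd : ∀ x ∈ V, ∀ y ∈ V, bxor x y ∈ V)
    (hM : ∀ u ∈ V, ∀ v ∈ V, ∀ y, (g y ^^ g (bxor y u) ^^ g (bxor y v) ^^ g (bxor y (bxor u v))) = false)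
    (x : Fin n → Bool) :
    W (fun y => signOf (g y)) x =
      ∑ z, if (∀ v ∈ V, twist x v = signOf (g (bxor z v)) * signOf (g z))
        then signOf (g z) * twist z x else 0 := by
  -- each coset sum of `(-1)^{g(y)+y·x}` is `|V|` times the matched summand
  have hcoset : ∀ z, ∑ e ∈ V, signOf (g (bxor z e)) * twist (bxor z e) x =
      (V.card : ℝ) * (if (∀ v ∈ V, twist x v = signOf (g (bxor z v)) * signOf (g z))
        then signOf (g z) * twist z x else 0) := by
    intro z
    have e1 : ∀ e ∈ V, signOf (g (bxor z e)) * twist (bxor z e) x =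
        signOf (g z) * twist z x * (signOf (g (bxor z e)) * signOf (g z) * twist x e) := by
      intro e _
      rw [twist_bxor_left, twist_comm e x]
      have s := signOf_sq (g z)
      calc signOf (g (bxor z e)) * (twist z x * twist x e)
          = signOf (g (bxor z e)) * (twist z x * twist x e) * signOf (g z) ^ 2 := by rw [s, mul_one]
        _ = _ := by ring
    rw [sum_congr rfl e1, ← mul_sum]
    rcases stub_dualValue_dichotomy g h0 hadd hM z x with ⟨hs, hm⟩ | ⟨hs, hm⟩
    · rw [hs, if_pos hm]; ring
    · rw [hs, if_neg hm]; ring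
  have hV : (0 : ℝ) < V.card := by exact_mod_cast card_pos.2 ⟨_, h0⟩
  -- sum over `z`: the left-hand sides add up to `|V| · W_g(x)`
  have htot : ∑ z, ∑ e ∈ V, signOf (g (bxor z e)) * twist (bxor z e) x =
      (V.card : ℝ) * W (fun y => signOf (g y)) x := by
    rw [sum_comm]
    have e2 : ∀ e ∈ V, ∑ z, signOf (g (bxor z e)) * twist (bxor z e) x =
        W (fun y => signOf (g y)) x := by
      intro e _
      rw [W, ← Equiv.sum_comp (bxorPerm e) (fun y => signOf (g y) * twist y x)]
      refine sum_congr rfl fun z _ => ?_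
      simp only [bxorPerm_apply]
      rw [bxor_comm e z]
    rw [sum_congr rfl e2, sum_const, nsmul_eq_mul]
  have key : (V.card : ℝ) * W (fun y => signOf (g y)) x =
      (V.card : ℝ) * ∑ z, (if (∀ v ∈ V, twist x v = signOf (g (bxor z v)) * signOf (g z))
        then signOf (g z) * twist z x else 0) := by
    rw [← htot, mul_sum]
    exact sum_congr rfl fun z _ => hcoset z
  exact mul_left_cancel₀ hV.ne' key

/-- **Dual-value identity** (stub `stub_dualValue` of the line `polar-radical-seeds`). If `g` is affine on
the cosets of a `⊕`-closed `V ∋ 0` (all second differences along `V` vanish) then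
(a) for EVERY `f`, `Σ_z Σ_{x ≡ z} (-1)^{f x} (-1)^{g z} (-1)^{x·z} = √(2^{3n}) · Φ(f,g)`, where `x ≡ z`
means that the character `v ↦ (-1)^{x·v}` of `V` is the linear part `v ↦ (-1)^{g(z ⊕ v) + g z}` of `g` on
`z ⊕ V` (for each `x` the `z`-sum over the matching `z` is `W_g(x)`), and
(b) for every `z` the matching `x` form a coset of `V^⊥`: `#{x ≡ z} · |V| = 2ⁿ`.
No bentness, no half-dimension needed. -/
theorem stub_dualValue : ∀ (n : ℕ) (f g : (Fin n → Bool) → Bool) (V : Finset (Fin n → Bool)),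
    zeroVec ∈ V → (∀ x ∈ V, ∀ y ∈ V, bxor x y ∈ V) →
    (∀ u ∈ V, ∀ v ∈ V, ∀ y, (g y ^^ g (bxor y u) ^^ g (bxor y v) ^^ g (bxor y (bxor u v))) = false) →
    (∑ z : Fin n → Bool,
        ∑ x ∈ univ.filter (fun x => ∀ v ∈ V, twist x v = signOf (g (bxor z v)) * signOf (g z)),
          signOf (f x) * signOf (g z) * twist x z =
      Real.sqrt (2 ^ (3 * n)) * forrelation f g) ∧
    (∀ z : Fin n → Bool,
      ((univ.filter (fun x => ∀ v ∈ V, twist x v = signOf (g (bxor z v)) * signOf (g z))).card : ℝ) *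
        V.card = (2 : ℝ) ^ n) := by
  intro n f g V h0 hadd hM
  refine ⟨?_, fun z => stub_dualValue_card g h0 hadd hM z⟩
  rw [← fsum_signOf_eq, fsum_eq_sum_mul_W]
  calc ∑ z : Fin n → Bool,
        ∑ x ∈ univ.filter (fun x => ∀ v ∈ V, twist x v = signOf (g (bxor z v)) * signOf (g z)),
          signOf (f x) * signOf (g z) * twist x z
      = ∑ z : Fin n → Bool, ∑ x : Fin n → Bool,
          if (∀ v ∈ V, twist x v = signOf (g (bxor z v)) * signOf (g z))
            then signOf (f x) * signOf (g z) * twist x z else 0 := by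
        simp only [sum_filter]
    _ = ∑ x : Fin n → Bool, ∑ z : Fin n → Bool,
          if (∀ v ∈ V, twist x v = signOf (g (bxor z v)) * signOf (g z))
            then signOf (f x) * signOf (g z) * twist x z else 0 := sum_comm
    _ = ∑ x : Fin n → Bool, signOf (f x) * W (fun y => signOf (g y)) x := by
        refine sum_congr rfl fun x _ => ?_
        rw [stub_dualValue_W g h0 hadd hM x, mul_sum]
        refine sum_congr rfl fun z _ => ?_
        rw [twist_comm x z]
        split_ifs <;> ring

end Summit.QuantumAdvantage.QuantumAdvantage.Theorems.SignedCubicForrelationInPrBPP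

end
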